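import Mathlib
import HarnessLib
import Summits.HubbardSuperconductivity.HubbardSuperconductivity.Theorems.KLProgrammeKLRegimeTwoPointLimitCooperResummationFlow

/-!
# Route `KLProgramme`, crux K3 (stmt-HubbardSuperconductivity-19937), child 1 `KLRegimeBetaSplit` — the Cooper resummation as a
# FLOW, part 2: the resolvent identity, LIPSCHITZ continuity in the max-entry norm (constant `36`, uniform in the mass) and the
# COMPOSITION law (cell gate-hubbard-kl, seat p1 = C1 lead, g5)

Sequel to `…CooperResummation` (`klcr_resummed_entry_le`) and `…CooperResummationFlow` (`klcrf_structure`); notation as there: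
`F_w(X) := (1 + X·diag w)⁻¹·X`, `X = u·J + 𝒟`, `u ≥ 0`, `|𝒟| ≤ δ`, `W·δ ≤ 1/3`.

* `klcrf_resolvent_identity`: `F(X₁) − F(X₂) = (1 + X₁D)⁻¹·(X₁ − X₂)·(1 − D·F(X₂))` (with the push-through `F(X₂) = X₂(1 − D F(X₂))`);
* `klcrf_lipschitz`: `|F_w(u·J + 𝒟₁) − F_w(u·J + 𝒟₂)| ≤ 36·max|𝒟₁ − 𝒟₂|` entrywise — the row sums of `(1 + X₁ diag w)⁻¹` and the
  weighted column sums of `1 − diag w·F(X₂)` are both `≤ 6` by the structure theorem; hence a source injected at one scale moves the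
  resummed array at every later scale by at most `36 ×` its size, with no amplification by `1 + u·W ≍ c/U`;
* `klcrf_compose`: `F_{D₂}(F_{D₁}(X)) = F_{D₁+D₂}(X)` whenever both resummations exist.

Pure finite-dimensional linear algebra; nothing about the model is asserted.  References: HOME/STATUS 2026-08-26T09:21:49Z (p1).
-/

noncomputable section

namespace Summit.HubbardSuperconductivity.HubbardSuperconductivity.Theorems.KLProgrammeCooperResummation

set_option linter.dupNamespace false -- summit = problem name (single-conjunct summit), D-0017

open scoped Matrix.Norms.Operator
open Matrix Finset
open Summit.HubbardSuperconductivity.HubbardSuperconductivity.Theorems.CooperChannelRiccatiFlow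

variable {S : Type*} [Fintype S] [DecidableEq S] [Nonempty S]

omit [Nonempty S] in
/-- **The resolvent identity** behind the Lipschitz bound: with `T_i = 1 + X_i·D` invertible,
`T₁⁻¹X₁ − T₂⁻¹X₂ = T₁⁻¹·(X₁ − X₂)·(1 − D·T₂⁻¹X₂)` (and `T₂⁻¹X₂ = X₂(1 − D·T₂⁻¹X₂)`, push-through). -/
theorem klcrf_resolvent_identity (X₁ X₂ D : Matrix S S ℂ) (h₁ : IsUnit (1 + X₁ * D)) (h₂ : IsUnit (1 + X₂ * D)) :
    (1 + X₁ * D)⁻¹ * X₁ - (1 + X₂ * D)⁻¹ * X₂ = (1 + X₁ * D)⁻¹ * (X₁ - X₂) * (1 - D * ((1 + X₂ * D)⁻¹ * X₂)) := by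
  set T₁ := 1 + X₁ * D with hT₁
  set T₂ := 1 + X₂ * D with hT₂
  have hd₁ : IsUnit T₁.det := (Matrix.isUnit_iff_isUnit_det _).mp h₁
  have hd₂ : IsUnit T₂.det := (Matrix.isUnit_iff_isUnit_det _).mp h₂
  have hinv₁ : T₁⁻¹ * T₁ = 1 := Matrix.nonsing_inv_mul _ hd₁
  have hinv₂ : T₂⁻¹ * T₂ = 1 := Matrix.nonsing_inv_mul _ hd₂
  have hinv₂' : T₂ * T₂⁻¹ = 1 := Matrix.mul_nonsing_inv _ hd₂
  -- push-through: `T₂⁻¹ X₂ = X₂ (1 - D T₂⁻¹ X₂)`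
  have hpush : T₂⁻¹ * X₂ = X₂ * (1 - D * (T₂⁻¹ * X₂)) := by
    have hcomm : T₂ * (X₂ * D) = (X₂ * D) * T₂ := by rw [hT₂]; noncomm_ring
    -- multiply the claim by `T₂` on the left
    have h : T₂ * (X₂ * (1 - D * (T₂⁻¹ * X₂))) = X₂ := by
      calc T₂ * (X₂ * (1 - D * (T₂⁻¹ * X₂))) = T₂ * X₂ - (T₂ * (X₂ * D)) * (T₂⁻¹ * X₂) := by noncomm_ring
        _ = T₂ * X₂ - (X₂ * D) * (T₂ * T₂⁻¹) * X₂ := by rw [hcomm]; noncomm_ring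
        _ = T₂ * X₂ - X₂ * D * X₂ := by rw [hinv₂']; noncomm_ring
        _ = X₂ := by rw [hT₂]; noncomm_ring
    calc T₂⁻¹ * X₂ = T₂⁻¹ * (T₂ * (X₂ * (1 - D * (T₂⁻¹ * X₂)))) := by rw [h]
      _ = X₂ * (1 - D * (T₂⁻¹ * X₂)) := by rw [← mul_assoc, hinv₂, one_mul]
  -- `T₁⁻¹ X₁ D = 1 - T₁⁻¹`
  have hTXD : T₁⁻¹ * X₁ * D = 1 - T₁⁻¹ := by
    have : T₁⁻¹ * (X₁ * D) = T₁⁻¹ * T₁ - T₁⁻¹ := by rw [hT₁]; noncomm_ring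
    rw [mul_assoc, this, hinv₁]
  symm
  calc T₁⁻¹ * (X₁ - X₂) * (1 - D * (T₂⁻¹ * X₂))
      = T₁⁻¹ * X₁ - (T₁⁻¹ * X₁ * D) * (T₂⁻¹ * X₂) - T₁⁻¹ * (X₂ * (1 - D * (T₂⁻¹ * X₂))) := by noncomm_ring
    _ = T₁⁻¹ * X₁ - (1 - T₁⁻¹) * (T₂⁻¹ * X₂) - T₁⁻¹ * (T₂⁻¹ * X₂) := by rw [hTXD, ← hpush]
    _ = T₁⁻¹ * X₁ - T₂⁻¹ * X₂ := by noncomm_ring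

/-- **Lipschitz continuity of the resummation in the max-entry norm, uniform in the mass** (what bounds the effect of a
source injected at any scale on every later scale).  For weights `w ≥ 0`, `W = Σ w`, `u ≥ 0` and two second-order parts
`|𝒟₁|, |𝒟₂| ≤ δ` with `W·δ ≤ 1/3`: every entry of `F_w(u·J + 𝒟₁) − F_w(u·J + 𝒟₂)` is at most `36·Δ` whenever `|𝒟₁ − 𝒟₂| ≤ Δ`
entrywise. -/
theorem klcrf_lipschitz (w : S → ℝ) (hw : ∀ s, 0 ≤ w s) {u δ Δ : ℝ} (hu : 0 ≤ u) (hδ : 0 ≤ δ) (hΔ : 0 ≤ Δ)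
    (𝒟₁ 𝒟₂ : Matrix S S ℂ) (h𝒟₁ : ∀ s t, ‖𝒟₁ s t‖ ≤ δ) (h𝒟₂ : ∀ s t, ‖𝒟₂ s t‖ ≤ δ)
    (hdiff : ∀ s t, ‖𝒟₁ s t - 𝒟₂ s t‖ ≤ Δ) (hθ : (∑ s, w s) * δ ≤ 1 / 3) (s t : S) :
    ‖((1 + (Matrix.of (fun _ _ : S => (u : ℂ)) + 𝒟₁) * Matrix.diagonal (fun s => (w s : ℂ)))⁻¹ *
          (Matrix.of (fun _ _ : S => (u : ℂ)) + 𝒟₁) -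
        (1 + (Matrix.of (fun _ _ : S => (u : ℂ)) + 𝒟₂) * Matrix.diagonal (fun s => (w s : ℂ)))⁻¹ *
          (Matrix.of (fun _ _ : S => (u : ℂ)) + 𝒟₂)) s t‖ ≤ 36 * Δ := by
  set W : ℝ := ∑ s, w s with hW_def
  have hW : 0 ≤ W := sum_nonneg fun s _ => hw s
  set D : Matrix S S ℂ := Matrix.diagonal (fun s => (w s : ℂ)) with hD_def
  set J : Matrix S S ℂ := Matrix.of (fun _ _ : S => (u : ℂ)) with hJ_def
  set X₁ : Matrix S S ℂ := J + 𝒟₁ with hX₁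
  set X₂ : Matrix S S ℂ := J + 𝒟₂ with hX₂
  obtain ⟨hU₁, hrow₁, -⟩ := klcrf_structure w hw hu hδ 𝒟₁ h𝒟₁ hθ
  obtain ⟨hU₂, -, hstr₂⟩ := klcrf_structure w hw hu hδ 𝒟₂ h𝒟₂ hθ
  rw [klcrf_resolvent_identity X₁ X₂ D hU₁ hU₂]
  set P : Matrix S S ℂ := (1 + X₁ * D)⁻¹ with hP
  set F₂ : Matrix S S ℂ := (1 + X₂ * D)⁻¹ * X₂ with hF₂
  have hX12 : X₁ - X₂ = 𝒟₁ - 𝒟₂ := by rw [hX₁, hX₂]; abel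
  rw [hX12]
  -- weighted column sums of `F₂`: `Σ_q w_q |F₂ q t'| ≤ 5`
  have hcas_nonneg : 0 ≤ cascadeStep W u := by
    rw [cascadeStep]; exact div_nonneg hu (by nlinarith [mul_nonneg hW hu])
  have hcas_le : W * cascadeStep W u ≤ 1 := by
    rw [cascadeStep, mul_div_assoc', div_le_one (by nlinarith [mul_nonneg hW hu])]; linarith
  have hF₂entry : ∀ q t', ‖F₂ q t'‖ ≤ cascadeStep W u + 12 * δ := by
    intro q t'
    have h := hstr₂ q t'
    calc ‖F₂ q t'‖ = ‖(F₂ q t' - (cascadeStep W u : ℝ)) + (cascadeStep W u : ℝ)‖ := by rw [sub_add_cancel]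
      _ ≤ ‖F₂ q t' - (cascadeStep W u : ℝ)‖ + ‖((cascadeStep W u : ℝ) : ℂ)‖ := norm_add_le _ _
      _ ≤ 12 * δ + cascadeStep W u := by
          rw [Complex.norm_real, Real.norm_eq_abs, abs_of_nonneg hcas_nonneg]; exact add_le_add h le_rfl
      _ = cascadeStep W u + 12 * δ := by ring
  have hMcol : ∀ t', ∑ q, ‖(1 - D * F₂) q t'‖ ≤ 6 := by
    intro t'
    have hθ' : W * δ ≤ 1 / 3 := hθ
    calc ∑ q, ‖(1 - D * F₂) q t'‖ ≤ ∑ q, (‖(1 : Matrix S S ℂ) q t'‖ + w q * ‖F₂ q t'‖) := sum_le_sum fun q _ => by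
            rw [Matrix.sub_apply]
            refine (norm_sub_le _ _).trans (add_le_add le_rfl ?_)
            rw [hD_def, Matrix.diagonal_mul, norm_mul, Complex.norm_real, Real.norm_eq_abs, abs_of_nonneg (hw q)]
      _ = ∑ q, ‖(1 : Matrix S S ℂ) q t'‖ + ∑ q, w q * ‖F₂ q t'‖ := sum_add_distrib
      _ ≤ 1 + ∑ q, w q * (cascadeStep W u + 12 * δ) := by
          refine add_le_add ?_ (sum_le_sum fun q _ => mul_le_mul_of_nonneg_left (hF₂entry q t') (hw q))
          rw [Finset.sum_eq_single t']
          · simp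
          · intro q _ hq; simp [Matrix.one_apply_ne hq]
          · simp
      _ = 1 + W * cascadeStep W u + 12 * (W * δ) := by rw [← Finset.sum_mul]; ring
      _ ≤ 1 + 1 + 12 * (1 / 3) := by gcongr
      _ = 6 := by norm_num
  -- the triple product, entrywise
  rw [Matrix.mul_assoc, Matrix.mul_apply]
  calc ‖∑ p, P s p * ((𝒟₁ - 𝒟₂) * (1 - D * F₂)) p t‖
      ≤ ∑ p, ‖P s p‖ * ‖((𝒟₁ - 𝒟₂) * (1 - D * F₂)) p t‖ := (norm_sum_le _ _).trans (le_of_eq (by simp_rw [norm_mul]))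
    _ ≤ ∑ p, ‖P s p‖ * (Δ * 6) := sum_le_sum fun p _ => mul_le_mul_of_nonneg_left ?_ (norm_nonneg _)
    _ = (∑ p, ‖P s p‖) * (Δ * 6) := by rw [Finset.sum_mul]
    _ ≤ 6 * (Δ * 6) := mul_le_mul_of_nonneg_right (hrow₁ s) (by positivity)
    _ = 36 * Δ := by ring
  -- `|((𝒟₁ - 𝒟₂)(1 - D F₂))_{pt}| ≤ Δ · Σ_q |(1 - D F₂)_{qt}| ≤ 6Δ`
  rw [Matrix.mul_apply]
  calc ‖∑ q, (𝒟₁ - 𝒟₂) p q * (1 - D * F₂) q t‖ ≤ ∑ q, ‖(𝒟₁ - 𝒟₂) p q‖ * ‖(1 - D * F₂) q t‖ :=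
        (norm_sum_le _ _).trans (le_of_eq (by simp_rw [norm_mul]))
    _ ≤ ∑ q, Δ * ‖(1 - D * F₂) q t‖ := sum_le_sum fun q _ =>
        mul_le_mul_of_nonneg_right (by rw [Matrix.sub_apply]; exact hdiff p q) (norm_nonneg _)
    _ = Δ * ∑ q, ‖(1 - D * F₂) q t‖ := by rw [Finset.mul_sum]
    _ ≤ Δ * 6 := mul_le_mul_of_nonneg_left (hMcol t) hΔ

omit [Nonempty S] in
/-- **Composition law** (Möbius maps compose additively in the mass): with `T₁ = 1 + X·D₁` and `T₁₂ = 1 + X·(D₁ + D₂)` invertible,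
`F_{D₂}(F_{D₁}(X)) = F_{D₁+D₂}(X)`, i.e. `(1 + (T₁⁻¹X)·D₂)⁻¹·(T₁⁻¹X) = T₁₂⁻¹·X` — resumming the shells one at a time or all at once is
the same ladder. -/
theorem klcrf_compose (X D₁ D₂ : Matrix S S ℂ) (h₁ : IsUnit (1 + X * D₁)) (h₁₂ : IsUnit (1 + X * (D₁ + D₂))) :
    (1 + ((1 + X * D₁)⁻¹ * X) * D₂)⁻¹ * ((1 + X * D₁)⁻¹ * X) = (1 + X * (D₁ + D₂))⁻¹ * X := by
  set T₁ := 1 + X * D₁ with hT₁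
  set T₁₂ := 1 + X * (D₁ + D₂) with hT₁₂
  have hd₁ : IsUnit T₁.det := (Matrix.isUnit_iff_isUnit_det _).mp h₁
  have hd₁₂ : IsUnit T₁₂.det := (Matrix.isUnit_iff_isUnit_det _).mp h₁₂
  have hinv₁ : T₁⁻¹ * T₁ = 1 := Matrix.nonsing_inv_mul _ hd₁
  have hinv₁' : T₁ * T₁⁻¹ = 1 := Matrix.mul_nonsing_inv _ hd₁
  have hinv₁₂ : T₁₂⁻¹ * T₁₂ = 1 := Matrix.nonsing_inv_mul _ hd₁₂
  have key : 1 + (T₁⁻¹ * X) * D₂ = T₁⁻¹ * T₁₂ := by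
    have : T₁⁻¹ * T₁₂ = T₁⁻¹ * T₁ + T₁⁻¹ * X * D₂ := by rw [hT₁₂, hT₁]; noncomm_ring
    rw [this, hinv₁]
  rw [key]
  -- `(T₁⁻¹ T₁₂)⁻¹ = T₁₂⁻¹ T₁`, by exhibiting the right inverse
  have hR : (T₁⁻¹ * T₁₂) * (T₁₂⁻¹ * T₁) = 1 := by
    calc (T₁⁻¹ * T₁₂) * (T₁₂⁻¹ * T₁) = T₁⁻¹ * (T₁₂ * T₁₂⁻¹) * T₁ := by noncomm_ring
      _ = 1 := by rw [Matrix.mul_nonsing_inv _ hd₁₂, mul_one, hinv₁]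
  rw [Matrix.inv_eq_right_inv hR]
  calc T₁₂⁻¹ * T₁ * (T₁⁻¹ * X) = T₁₂⁻¹ * (T₁ * T₁⁻¹) * X := by noncomm_ring
    _ = T₁₂⁻¹ * X := by rw [hinv₁', mul_one]

end Summit.HubbardSuperconductivity.HubbardSuperconductivity.Theorems.KLProgrammeCooperResummation

end
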